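import Summits.CriticalPhenomena.CardyFormulaZ2.Theorems.CardyBoundaryCoulombGasRectilinearCardyStubRowBlocksPart7
import Summits.CriticalPhenomena.CardyFormulaZ2.Theorems.LagHandOff.Negative.ArcSwap
import HarnessLib

/-!
# Stub B `stub_rowBlocks` of line `excursion-kernel-covariance`, part 14: one radius for the four
# zones
# (crux `RectilinearCardy`, stmt-CriticalPhenomena-5660, route `CardyBoundaryCoulombGas`)

Continuum set-up of the ROW BLOCKS stub, second half: a single radius `r ≤ rf` such that

* frontier points within `r` of each mark `∂D(tb), ∂D(ta), ∂D(td)` and of every window foot `∂D(tv)`,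
  `tv ∈ [w₁, w₁']`, have parameters within `θ` of the centre (`rb_near_param_of_flat`; the window bound
  is uniform by compactness, `rb_window_r1`);
* the three marks are pairwise `r`-apart and `r`-apart from every window foot (`rb_sep_inf`: a positive
  continuous function on a compact interval is bounded below; distinctness by injectivity of the loop
  on a period, `rb_bdy_ne`).

The finitely many smallness conditions are combined as eventual statements along `𝓝[>] 0`
(`rb_ev_le`). All [folklore].
-/

noncomputable section

open Set Metric Filter Topology
open Literature.Probability.RandomPlanarGeometry
open Literature.Probability.LatticeModels (Orient)
open Summit.CriticalPhenomena.CardyFormulaZ2.Theorems.LagHandOff.Negative (exists_int_of_boundary_eq)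

namespace Summit.CriticalPhenomena.CardyFormulaZ2.Cruxes.RectilinearCardy.ExcursionKernelCovariance

/-! ### Tools -/

/-- Small positive radii are eventually below any positive bound and positive. [folklore] -/
theorem rb_ev_le {ρ : ℝ} (hρ : 0 < ρ) : ∀ᶠ r in 𝓝[>] (0 : ℝ), 0 < r ∧ r ≤ ρ := by
  have h1 : ∀ᶠ r in 𝓝[>] (0 : ℝ), r ∈ Ioo (0 : ℝ) ρ := Ioo_mem_nhdsGT hρ
  exact h1.mono fun r hr => ⟨hr.1, hr.2.le⟩

/-- **Distinct boundary points**: parameters differing by a non-integer amount (`0 < t₀ - t < 1`)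
give distinct points. [folklore] -/
theorem rb_bdy_ne (D : JordanDomain) {t t₀ : ℝ} (h0 : t < t₀) (h1 : t₀ < t + 1) : D.boundary t₀ ≠ D.boundary t := by
  intro heq
  obtain ⟨z, hz⟩ := exists_int_of_boundary_eq D heq
  have hz0 : (0 : ℝ) < z := by rw [← hz]; linarith
  have hz1 : (z : ℝ) < 1 := by rw [← hz]; linarith
  have : (0 : ℤ) < z := by exact_mod_cast hz0
  have : z < 1 := by exact_mod_cast hz1
  omega

/-- **A point off a compact arc is at positive distance from it, uniformly**: if `∂D(t₀) ≠ ∂D(t)` for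
all `t ∈ [w₁, w₁']`, some `ρ > 0` bounds all these distances below. [folklore] -/
theorem rb_sep_inf (D : JordanDomain) {t₀ w₁ w₁' : ℝ} (hw : w₁ ≤ w₁')
    (hne : ∀ t ∈ Icc w₁ w₁', D.boundary t₀ ≠ D.boundary t) :
    ∃ ρ : ℝ, 0 < ρ ∧ ∀ t ∈ Icc w₁ w₁', ρ ≤ dist (D.boundary t₀) (D.boundary t) := by
  have hcont : ContinuousOn (fun t => dist (D.boundary t₀) (D.boundary t)) (Icc w₁ w₁') :=
    (continuous_const.dist D.continuous_boundary).continuousOn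
  obtain ⟨t₁, ht₁, hmin⟩ := isCompact_Icc.exists_isMinOn (nonempty_Icc.2 hw) hcont
  refine ⟨dist (D.boundary t₀) (D.boundary t₁), dist_pos.2 (hne t₁ ht₁), fun t ht => ?_⟩
  exact hmin ht

/-- **Uniform inverse modulus of the tangential coordinate along the window.** If `T` is continuous
and strictly monotone with sign `sT` on `[w₂, w₂']`, and `[w₁ - θ, w₁' + θ] ⊆ [w₂, w₂']`, `θ > 0`, then
ONE `ρ > 0` bounds `|T(tv ± θ) - T(tv)|` below for all `tv ∈ [w₁, w₁']` (minimum of a positive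
continuous function on a compact interval). [folklore] -/
theorem rb_window_r1 {T : ℝ → ℝ} (hcont : Continuous T) {sT w₁ w₁' w₂ w₂' θ : ℝ} (hθ : 0 < θ) (hw : w₁ ≤ w₁')
    (hw₂ : w₂ + θ ≤ w₁) (hw₂' : w₁' + θ ≤ w₂')
    (hsign : ∀ t ∈ Icc w₂ w₂', ∀ t' ∈ Icc w₂ w₂', t < t' → 0 < sT * (T t' - T t)) :
    ∃ ρ : ℝ, 0 < ρ ∧ ∀ tv ∈ Icc w₁ w₁', ρ ≤ |T (tv + θ) - T tv| ∧ ρ ≤ |T (tv - θ) - T tv| := by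
  have hpos : ∀ t ∈ Icc w₂ w₂', ∀ t' ∈ Icc w₂ w₂', t < t' → 0 < |T t' - T t| := by
    intro t ht t' ht' htt'
    have := hsign t ht t' ht' htt'
    rw [abs_pos]
    intro h0; rw [h0, mul_zero] at this; exact lt_irrefl _ this
  have hc1 : ContinuousOn (fun t => |T (t + θ) - T t|) (Icc w₁ w₁') :=
    (((hcont.comp (continuous_id.add continuous_const)).sub hcont).abs).continuousOn
  have hc2 : ContinuousOn (fun t => |T (t - θ) - T t|) (Icc w₁ w₁') :=
    (((hcont.comp (continuous_id.sub continuous_const)).sub hcont).abs).continuousOn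
  obtain ⟨t₁, ht₁, hmin1⟩ := isCompact_Icc.exists_isMinOn (nonempty_Icc.2 hw) hc1
  obtain ⟨t₂, ht₂, hmin2⟩ := isCompact_Icc.exists_isMinOn (nonempty_Icc.2 hw) hc2
  have h1 : 0 < |T (t₁ + θ) - T t₁| :=
    hpos t₁ ⟨by linarith [ht₁.1], by linarith [ht₁.2]⟩ (t₁ + θ) ⟨by linarith [ht₁.1], by linarith [ht₁.2]⟩ (by linarith)
  have h2 : 0 < |T (t₂ - θ) - T t₂| := by
    rw [abs_sub_comm]
    exact hpos (t₂ - θ) ⟨by linarith [ht₂.1], by linarith [ht₂.2]⟩ t₂ ⟨by linarith [ht₂.1], by linarith [ht₂.2]⟩ (by linarith)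
  refine ⟨min (|T (t₁ + θ) - T t₁|) (|T (t₂ - θ) - T t₂|), lt_min h1 h2, fun tv htv => ⟨?_, ?_⟩⟩
  · exact (min_le_left _ _).trans (hmin1 htv)
  · exact (min_le_right _ _).trans (hmin2 htv)

/-! ### One radius for the four zones -/

/-- **One radius for the four zones.** See the module docstring. Inputs: frames at the marks
`∂D(tb), ∂D(ta), ∂D(td)` and at every window point `∂D(t)`, `t ∈ [w₂, w₂']`, with radius `rf`; the
motion bound `|s - t| ≤ 2θ → dist < rf/8`; tangential signs at the marks on `|· - t_| ≤ 2θ` and along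
the window; and the parameter order `w₂ + 2θ ≤ w₁ ≤ w₁' ≤ w₂' - 2θ < tb < ta < td < w₁ + 1`. [folklore] -/
theorem rb_radius (D : JordanDomain) {ow ob oa od : Orient} {Hw Hb Ha Hd rf θ sTw sTb sTa sTd tb ta td w₁ w₁' w₂ w₂' : ℝ}
    (hrf : 0 < rf) (hθ : 0 < θ) (hw : w₁ ≤ w₁') (hw₂ : w₂ + 2 * θ ≤ w₁) (hw₂' : w₁' + 2 * θ ≤ w₂')
    (hord : w₂' < tb ∧ tb < ta ∧ ta < td ∧ td < w₁ + 1)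
    (hwin : ∀ t ∈ Icc w₂ w₂', Orient.nrmC ow (D.boundary t) = Hw ∧
      (∀ z, dist z (D.boundary t) < rf → (z ∈ closure D.carrier ↔ Hw ≤ Orient.nrmC ow z)) ∧
      (∀ z, dist z (D.boundary t) < rf → (z ∈ D.carrier ↔ Hw < Orient.nrmC ow z)))
    (hclb : ∀ z, dist z (D.boundary tb) < rf → (z ∈ closure D.carrier ↔ Hb ≤ Orient.nrmC ob z))
    (hopb : ∀ z, dist z (D.boundary tb) < rf → (z ∈ D.carrier ↔ Hb < Orient.nrmC ob z))
    (hcla : ∀ z, dist z (D.boundary ta) < rf → (z ∈ closure D.carrier ↔ Ha ≤ Orient.nrmC oa z))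
    (hopa : ∀ z, dist z (D.boundary ta) < rf → (z ∈ D.carrier ↔ Ha < Orient.nrmC oa z))
    (hcld : ∀ z, dist z (D.boundary td) < rf → (z ∈ closure D.carrier ↔ Hd ≤ Orient.nrmC od z))
    (hopd : ∀ z, dist z (D.boundary td) < rf → (z ∈ D.carrier ↔ Hd < Orient.nrmC od z))
    (hmove : ∀ s t : ℝ, |s - t| ≤ 2 * θ → dist (D.boundary s) (D.boundary t) < rf / 8)
    (hsTw : sTw = 1 ∨ sTw = -1) (hsTb : sTb = 1 ∨ sTb = -1) (hsTa : sTa = 1 ∨ sTa = -1) (hsTd : sTd = 1 ∨ sTd = -1)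
    (hTw : ∀ t ∈ Icc w₂ w₂', ∀ t' ∈ Icc w₂ w₂', t < t' → 0 < sTw * (Orient.tngC ow (D.boundary t') - Orient.tngC ow (D.boundary t)))
    (hTb : ∀ t t' : ℝ, |t - tb| ≤ 2 * θ → |t' - tb| ≤ 2 * θ → t < t' → 0 < sTb * (Orient.tngC ob (D.boundary t') - Orient.tngC ob (D.boundary t)))
    (hTa : ∀ t t' : ℝ, |t - ta| ≤ 2 * θ → |t' - ta| ≤ 2 * θ → t < t' → 0 < sTa * (Orient.tngC oa (D.boundary t') - Orient.tngC oa (D.boundary t)))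
    (hTd : ∀ t t' : ℝ, |t - td| ≤ 2 * θ → |t' - td| ≤ 2 * θ → t < t' → 0 < sTd * (Orient.tngC od (D.boundary t') - Orient.tngC od (D.boundary t))) :
    ∃ r : ℝ, 0 < r ∧ r ≤ rf ∧
      (∀ z ∈ frontier D.carrier, dist z (D.boundary tb) < r → ∃ t, |t - tb| ≤ θ ∧ D.boundary t = z) ∧
      (∀ z ∈ frontier D.carrier, dist z (D.boundary ta) < r → ∃ t, |t - ta| ≤ θ ∧ D.boundary t = z) ∧
      (∀ z ∈ frontier D.carrier, dist z (D.boundary td) < r → ∃ t, |t - td| ≤ θ ∧ D.boundary t = z) ∧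
      (∀ tv ∈ Icc w₁ w₁', ∀ z ∈ frontier D.carrier, dist z (D.boundary tv) < r → ∃ t, |t - tv| ≤ θ ∧ D.boundary t = z) ∧
      (∀ t ∈ Icc w₁ w₁', r ≤ dist (D.boundary tb) (D.boundary t) ∧ r ≤ dist (D.boundary ta) (D.boundary t) ∧
        r ≤ dist (D.boundary td) (D.boundary t)) ∧
      r ≤ dist (D.boundary tb) (D.boundary ta) ∧ r ≤ dist (D.boundary ta) (D.boundary td) ∧ r ≤ dist (D.boundary tb) (D.boundary td) := by
  -- the near-parameter statement at one centre, for small radii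
  have hnear_of : ∀ {o : Orient} {h t₀ sT : ℝ}, (sT = 1 ∨ sT = -1) →
      (∀ z, dist z (D.boundary t₀) < rf → (z ∈ closure D.carrier ↔ h ≤ Orient.nrmC o z)) →
      (∀ z, dist z (D.boundary t₀) < rf → (z ∈ D.carrier ↔ h < Orient.nrmC o z)) →
      (∀ t t' : ℝ, |t - t₀| ≤ θ → |t' - t₀| ≤ θ → t < t' → 0 < sT * (Orient.tngC o (D.boundary t') - Orient.tngC o (D.boundary t))) →
      ∀ᶠ r in 𝓝[>] (0 : ℝ), ∀ z ∈ frontier D.carrier, dist z (D.boundary t₀) < r → ∃ t, |t - t₀| ≤ θ ∧ D.boundary t = z := by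
    intro o h t₀ sT hsT hcl hop hT
    have hp : |t₀ + θ - t₀| ≤ θ := by rw [add_sub_cancel_left, abs_of_pos hθ]
    have hm : |t₀ - θ - t₀| ≤ θ := by rw [sub_sub_cancel_left, abs_neg, abs_of_pos hθ]
    have h0 : |t₀ - t₀| ≤ θ := by simp; exact hθ.le
    have h1 : 0 < |Orient.tngC o (D.boundary (t₀ + θ)) - Orient.tngC o (D.boundary t₀)| := by
      have := hT t₀ (t₀ + θ) h0 hp (by linarith)
      rw [abs_pos]; intro h0'; rw [h0', mul_zero] at this; exact lt_irrefl _ this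
    have h2 : 0 < |Orient.tngC o (D.boundary (t₀ - θ)) - Orient.tngC o (D.boundary t₀)| := by
      have := hT (t₀ - θ) t₀ hm h0 (by linarith)
      rw [abs_sub_comm, abs_pos]; intro h0'; rw [h0', mul_zero] at this; exact lt_irrefl _ this
    filter_upwards [rb_ev_le (lt_min (lt_min h1 h2) hrf)] with r hr
    exact rb_near_param_of_flat D hθ.le hcl hop (fun t ht => by have := hmove t t₀ (by linarith); linarith) hsT hT
      ⟨(hr.2.trans (min_le_left _ _)).trans (min_le_left _ _), (hr.2.trans (min_le_left _ _)).trans (min_le_right _ _)⟩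
      (hr.2.trans (min_le_right _ _))
  have hTb' : ∀ t t' : ℝ, |t - tb| ≤ θ → |t' - tb| ≤ θ → t < t' → 0 < sTb * (Orient.tngC ob (D.boundary t') - Orient.tngC ob (D.boundary t)) :=
    fun t t' ht ht' htt' => hTb t t' (by linarith) (by linarith) htt'
  have hTa' : ∀ t t' : ℝ, |t - ta| ≤ θ → |t' - ta| ≤ θ → t < t' → 0 < sTa * (Orient.tngC oa (D.boundary t') - Orient.tngC oa (D.boundary t)) :=
    fun t t' ht ht' htt' => hTa t t' (by linarith) (by linarith) htt'
  have hTd' : ∀ t t' : ℝ, |t - td| ≤ θ → |t' - td| ≤ θ → t < t' → 0 < sTd * (Orient.tngC od (D.boundary t') - Orient.tngC od (D.boundary t)) :=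
    fun t t' ht ht' htt' => hTd t t' (by linarith) (by linarith) htt'
  have evb := hnear_of hsTb hclb hopb hTb'
  have eva := hnear_of hsTa hcla hopa hTa'
  have evd := hnear_of hsTd hcld hopd hTd'
  -- the window: uniform inverse modulus
  obtain ⟨ρw, hρw, hρwle⟩ := rb_window_r1 ((kwl_continuous_tngC ow).comp D.continuous_boundary) (sT := sTw) hθ hw
    (by linarith) (by linarith) hTw
  have evw : ∀ᶠ r in 𝓝[>] (0 : ℝ), ∀ tv ∈ Icc w₁ w₁', ∀ z ∈ frontier D.carrier, dist z (D.boundary tv) < r →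
      ∃ t, |t - tv| ≤ θ ∧ D.boundary t = z := by
    filter_upwards [rb_ev_le (lt_min hρw hrf)] with r hr
    intro tv htv
    have htv₂ : tv ∈ Icc w₂ w₂' := ⟨by linarith [htv.1], by linarith [htv.2]⟩
    obtain ⟨-, hcl, hop⟩ := hwin tv htv₂
    have hT : ∀ t t' : ℝ, |t - tv| ≤ θ → |t' - tv| ≤ θ → t < t' →
        0 < sTw * (Orient.tngC ow (D.boundary t') - Orient.tngC ow (D.boundary t)) := by
      intro t t' ht ht' htt'
      rw [abs_le] at ht ht'
      exact hTw t ⟨by linarith [htv.1], by linarith [htv.2]⟩ t' ⟨by linarith [htv.1], by linarith [htv.2]⟩ htt'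
    exact rb_near_param_of_flat D hθ.le hcl hop (fun t ht => by have := hmove t tv (by linarith); linarith) hsTw hT
      ⟨(hr.2.trans (min_le_left _ _)).trans (hρwle tv htv).1, (hr.2.trans (min_le_left _ _)).trans (hρwle tv htv).2⟩
      (hr.2.trans (min_le_right _ _))
  -- separations
  have hsep_of : ∀ {t₀ : ℝ}, w₁' < t₀ → t₀ < w₁ + 1 →
      ∀ᶠ r in 𝓝[>] (0 : ℝ), ∀ t ∈ Icc w₁ w₁', r ≤ dist (D.boundary t₀) (D.boundary t) := by
    intro t₀ h1 h2
    obtain ⟨ρ, hρ, hρle⟩ := rb_sep_inf D hw fun t ht => rb_bdy_ne D (by linarith [ht.2]) (by linarith [ht.1])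
    filter_upwards [rb_ev_le hρ] with r hr
    exact fun t ht => hr.2.trans (hρle t ht)
  have evsb := hsep_of (t₀ := tb) (by linarith) (by linarith)
  have evsa := hsep_of (t₀ := ta) (by linarith) (by linarith)
  have evsd := hsep_of (t₀ := td) (by linarith) (by linarith)
  have hba : 0 < dist (D.boundary tb) (D.boundary ta) := by
    rw [dist_comm]; exact dist_pos.2 (rb_bdy_ne D hord.2.1 (by linarith))
  have had : 0 < dist (D.boundary ta) (D.boundary td) := by
    rw [dist_comm]; exact dist_pos.2 (rb_bdy_ne D hord.2.2.1 (by linarith))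
  have hbd : 0 < dist (D.boundary tb) (D.boundary td) := by
    rw [dist_comm]; exact dist_pos.2 (rb_bdy_ne D (by linarith) (by linarith))
  obtain ⟨r, ⟨hr0, hrf'⟩, hb, ha, hd, hwn, hsb, hsa, hsd, h1, h2, h3⟩ :=
    ((rb_ev_le hrf).and (evb.and (eva.and (evd.and (evw.and (evsb.and (evsa.and (evsd.and
      ((rb_ev_le hba).and ((rb_ev_le had).and (rb_ev_le hbd))))))))))).exists
  exact ⟨r, hr0, hrf', hb, ha, hd, hwn, fun t ht => ⟨hsb t ht, hsa t ht, hsd t ht⟩, h1.2, h2.2, h3.2⟩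

end Summit.CriticalPhenomena.CardyFormulaZ2.Cruxes.RectilinearCardy.ExcursionKernelCovariance

end
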